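import Literature.AlgebraicGeometry.HodgeTheory.WeilClassesHodgeType
import Literature.AlgebraicGeometry.HodgeTheory.WeilPlaneFibreCharts
import HarnessLib

/-!
# Eigen-Hodge numbers through a compatible chart, and a counting lemma for balanced Weil type

Family `hodge`, layer `Literature/AlgebraicGeometry/HodgeTheory`. Companion of
`WeilPlaneFibreCharts` (eigenvectors of `g_Y^*` and `φ^*` through a chart `e : A.X ≅ Y` with
`e.hom ≫ g_Y = φ ≫ e.hom`), `DegreeOneHodgeTypes` (`hodgeOneZero hX = H^{1,0} ⊆ H¹(X(ℂ); ℂ)`, the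
`K`-multiplicities `p_μ = dim (V_μ ∩ H^{1,0})` of van Geemen, LNM 1594, 4.9) and
`WeilClassesHodgeType` (balanced Weil type `dim (V₊ ∩ H^{1,0}) = k`, Deligne–Milne LNM 900 (4.4)).
A fibre `Y = 𝒳_s` of a family of abelian varieties is an abstract smooth projective `ℂ`-scheme with
a CHART `e : A.X ≅ Y` from (the scheme of) an abelian variety `A`, under which the global
endomorphism of the family restricted to the fibre, `g_Y : Y ⟶ Y`, corresponds to `φ ∈ End A`.
This file proves that the two numbers entering "balanced Weil type" are read equally on both sides
of such a chart, and the counting lemma by which balancedness propagates: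

* `finrank_eq_of_linearMap_inverse` — two subspaces exchanged by a pair of mutually inverse linear
  maps have the same dimension (linear algebra);
* `finrank_eigenspace_eq_of_iso` — **`dim ker(g_Y^* - μ) = dim ker(φ^* - μ)`** on `Hᵏ`: `e^*` is a
  linear isomorphism with inverse `(e⁻¹)^*` (`complexBetti.map_comp`, `e.inv_hom_id`) carrying
  `μ`-eigenvectors to `μ`-eigenvectors both ways (`map_hom/inv_mem_eigenspace_of_comm`);
* `finrank_eigenspace_inf_hodgeOneZero_eq_of_iso` — **`p_μ(Y, g_Y) = p_μ(A, φ)`**: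
  `dim (ker(g_Y^* - μ) ∩ H^{1,0}(Y)) = dim (ker(φ^* - μ) ∩ H^{1,0}(A))`, as moreover pull-backs
  along morphisms of smooth projective varieties preserve Hodge types
  (`IsOfHodgeType.map_of_isSmoothProjective`, Voisin I §7.3.2);
* `finrank_add_finrank_le_of_inf_eq_bot`, `finrank_eq_of_disjoint_pieces` — the counting lemma:
  inside a `2k`-dimensional `E` with `dim A + dim B = 2k` and two `k`-dimensional subspaces
  `W₁`, `W₂` with (`W₁ ∩ B = 0` and `W₂ ∩ A = 0`) or (`W₁ ∩ A = 0` and `W₂ ∩ B = 0`), one has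
  `dim A = k` (Grassmann's formula).

These are the fibrewise inputs of the propagation of balanced Weil type along Deligne's Weil family
([Deligne1982HodgeCycles, proof of Thm. 4.8 and Prop. 4.4]; [vanGeemen1994HodgeAV, 4.9–4.10]).
No definition, no named fact; relies on nothing unproved.

## References

* [Deligne1982HodgeCycles] P. Deligne (notes by J. S. Milne), Hodge cycles on abelian varieties,
  LNM 900 (1982), §4, Prop. 4.4 and proof of Thm. 4.8.
* [vanGeemen1994HodgeAV] B. van Geemen, An introduction to the Hodge conjecture for abelian
  varieties, LNM 1594 (1994), 4.9, 4.10, Lemma 5.2.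
* [VoisinHodgeI2002] C. Voisin, Hodge Theory and Complex Algebraic Geometry I (CUP 2002), §7.3.2.
-/

noncomputable section

open CategoryTheory AlgebraicGeometry
open Literature.AlgebraicTopology.SingularHomology

namespace Literature.AlgebraicGeometry.HodgeTheory

section HodgeTheory

/-! ### Linear algebra -/

section LinearAlgebra

/-- **Two subspaces exchanged by mutually inverse linear maps have the same dimension**: if
`g ∘ f = id`, `f ∘ g = id`, `f(S) ⊆ T` and `g(T) ⊆ S`, then `f` restricts to a linear isomorphism
`S ≃ T`, so `dim S = dim T`. [folklore] -/
theorem finrank_eq_of_linearMap_inverse {M N : Type*} [AddCommGroup M] [Module ℂ M] [AddCommGroup N]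
    [Module ℂ N] (f : M →ₗ[ℂ] N) (g : N →ₗ[ℂ] M) (hgf : ∀ x, g (f x) = x) (hfg : ∀ y, f (g y) = y)
    (S : Submodule ℂ M) (T : Submodule ℂ N) (hS : ∀ x ∈ S, f x ∈ T) (hT : ∀ y ∈ T, g y ∈ S) :
    Module.finrank ℂ S = Module.finrank ℂ T :=
  LinearEquiv.finrank_eq
    { toFun := fun x ↦ ⟨f x, hS x x.2⟩
      map_add' := fun x y ↦ Subtype.ext (f.map_add x y)
      map_smul' := fun c x ↦ Subtype.ext (f.map_smul c x)
      invFun := fun y ↦ ⟨g y, hT y y.2⟩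
      left_inv := fun x ↦ Subtype.ext (hgf x)
      right_inv := fun y ↦ Subtype.ext (hfg y) }

/-- **Grassmann inside a finite-dimensional subspace**: for `W, B ≤ E` with `W ∩ B = 0`,
`dim W + dim B = dim (W + B) ≤ dim E`. [folklore] -/
theorem finrank_add_finrank_le_of_inf_eq_bot {V : Type*} [AddCommGroup V] [Module ℂ V]
    {E W B : Submodule ℂ V} [Module.Finite ℂ E] (hW : W ≤ E) (hB : B ≤ E) (hWB : W ⊓ B = ⊥) :
    Module.finrank ℂ W + Module.finrank ℂ B ≤ Module.finrank ℂ E := by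
  haveI : FiniteDimensional ℂ W := Submodule.finiteDimensional_of_le hW
  haveI : FiniteDimensional ℂ B := Submodule.finiteDimensional_of_le hB
  have h := Submodule.finrank_sup_add_finrank_inf_eq W B
  rw [hWB, finrank_bot, add_zero] at h
  rw [← h]
  exact Submodule.finrank_mono (sup_le hW hB)

/-- **The counting lemma for the propagation of balanced Weil type**: in a `2k`-dimensional `E`
containing `A`, `B` with `dim A + dim B = 2k` and two `k`-dimensional `W₁`, `W₂`, if
(`W₁ ∩ B = 0` and `W₂ ∩ A = 0`) or (`W₁ ∩ A = 0` and `W₂ ∩ B = 0`), then `dim A = k`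
(each disjointness bounds `k + dim B ≤ 2k`, resp. `k + dim A ≤ 2k`). [folklore] -/
theorem finrank_eq_of_disjoint_pieces {V : Type*} [AddCommGroup V] [Module ℂ V]
    {E A B W₁ W₂ : Submodule ℂ V} [Module.Finite ℂ E] {k : ℕ}
    (hE : Module.finrank ℂ E = 2 * k) (hA : A ≤ E) (hB : B ≤ E) (hW₁ : W₁ ≤ E) (hW₂ : W₂ ≤ E)
    (hAB : Module.finrank ℂ A + Module.finrank ℂ B = 2 * k)
    (h₁ : Module.finrank ℂ W₁ = k) (h₂ : Module.finrank ℂ W₂ = k)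
    (hdis : (W₁ ⊓ B = ⊥ ∧ W₂ ⊓ A = ⊥) ∨ (W₁ ⊓ A = ⊥ ∧ W₂ ⊓ B = ⊥)) :
    Module.finrank ℂ A = k := by
  rcases hdis with ⟨h1B, h2A⟩ | ⟨h1A, h2B⟩
  · have hb := finrank_add_finrank_le_of_inf_eq_bot hW₁ hB h1B
    have ha := finrank_add_finrank_le_of_inf_eq_bot hW₂ hA h2A
    omega
  · have ha := finrank_add_finrank_le_of_inf_eq_bot hW₁ hA h1A
    have hb := finrank_add_finrank_le_of_inf_eq_bot hW₂ hB h2B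
    omega

end LinearAlgebra

/-! ### Through a compatible chart -/

section Chart

variable {A : Motives.AbelianVariety ℂ} {Y : Motives.SchemeOver ℂ} {n : ℕ}

/-- `(e⁻¹)^* (e^* c) = c` on `Hᵏ(Y(ℂ); ℂ)` for a chart `e : A.X ≅ Y`. [folklore] -/
theorem complexBetti_map_inv_map_hom_of_chart (e : A.X ≅ Y) (k : ℕ) (c : complexBetti Y k) :
    complexBetti.map e.inv k (complexBetti.map e.hom k c) = c := by
  rw [← ModuleCat.comp_apply, ← complexBetti.map_comp, e.inv_hom_id, complexBetti.map_id]
  rfl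

/-- `e^* ((e⁻¹)^* c) = c` on `Hᵏ(A(ℂ); ℂ)` for a chart `e : A.X ≅ Y`. [folklore] -/
theorem complexBetti_map_hom_map_inv_of_chart (e : A.X ≅ Y) (k : ℕ) (c : complexBetti A.X k) :
    complexBetti.map e.hom k (complexBetti.map e.inv k c) = c := by
  rw [← ModuleCat.comp_apply, ← complexBetti.map_comp, e.hom_inv_id, complexBetti.map_id]
  rfl

/-- **`p_μ(Y, g_Y) = p_μ(A, φ)` through a compatible chart**: for `e : A.X ≅ Y` with
`e.hom ≫ g_Y = φ ≫ e.hom` (`Y` smooth projective of dimension `n = dim A`),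
`dim (ker(g_Y^* - μ) ∩ H^{1,0}(Y)) = dim (ker(φ^* - μ) ∩ H^{1,0}(A))` on `H¹`: `e^*` and `(e⁻¹)^*`
are mutually inverse, exchange `μ`-eigenvectors (`map_hom/inv_mem_eigenspace_of_comm`) and
preserve the Hodge type `(1, 0)` (`IsOfHodgeType.map_of_isSmoothProjective`). The
`K`-multiplicity of van Geemen 4.9 read on a fibre of a family.
[cite: vanGeemen1994HodgeAV, 4.9] -/
theorem finrank_eigenspace_inf_hodgeOneZero_eq_of_iso (hA : A.dim = n)
    (hY : Motives.IsSmoothProjective n Y) {φ : A ⟶ A} (e : A.X ≅ Y) (gY : Y ⟶ Y)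
    (he : e.hom ≫ gY = φ.hom.hom.hom ≫ e.hom) (μ : ℂ) :
    Module.finrank ℂ ↥(Module.End.eigenspace (complexBetti.map gY 1).hom μ ⊓ hodgeOneZero hY) =
      Module.finrank ℂ ↥(Module.End.eigenspace (complexBetti.map φ.hom.hom.hom 1).hom μ ⊓
        hodgeOneZero (Motives.isSmoothProjective_of_dim_eq' hA)) := by
  have hX := Motives.isSmoothProjective_of_dim_eq' hA
  exact finrank_eq_of_linearMap_inverse (complexBetti.map e.hom 1).hom
    (complexBetti.map e.inv 1).hom (complexBetti_map_inv_map_hom_of_chart e 1)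
    (complexBetti_map_hom_map_inv_of_chart e 1) _ _
    (fun x hx ↦ ⟨map_hom_mem_eigenspace_of_comm e gY he hx.1,
      IsOfHodgeType.map_of_isSmoothProjective hx.2 hX hY e.hom⟩)
    (fun y hy ↦ ⟨map_inv_mem_eigenspace_of_comm e gY he hy.1,
      IsOfHodgeType.map_of_isSmoothProjective hy.2 hY hX e.inv⟩)

/-- **`dim ker(g_Y^* - μ) = dim ker(φ^* - μ)` on `Hᵏ` through a compatible chart** `e : A.X ≅ Y`,
`e.hom ≫ g_Y = φ ≫ e.hom`: `e^*` and `(e⁻¹)^*` are mutually inverse and exchange `μ`-eigenvectors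
(`map_hom/inv_mem_eigenspace_of_comm`). [folklore] -/
theorem finrank_eigenspace_eq_of_iso {φ : A ⟶ A} (e : A.X ≅ Y) (gY : Y ⟶ Y)
    (he : e.hom ≫ gY = φ.hom.hom.hom ≫ e.hom) (μ : ℂ) (k : ℕ) :
    Module.finrank ℂ ↥(Module.End.eigenspace (complexBetti.map gY k).hom μ) =
      Module.finrank ℂ ↥(Module.End.eigenspace (complexBetti.map φ.hom.hom.hom k).hom μ) :=
  finrank_eq_of_linearMap_inverse (complexBetti.map e.hom k).hom (complexBetti.map e.inv k).hom
    (complexBetti_map_inv_map_hom_of_chart e k) (complexBetti_map_hom_map_inv_of_chart e k) _ _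
    (fun _ hx ↦ map_hom_mem_eigenspace_of_comm e gY he hx)
    (fun _ hy ↦ map_inv_mem_eigenspace_of_comm e gY he hy)

end Chart

end HodgeTheory

end Literature.AlgebraicGeometry.HodgeTheory

end
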